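import Summits.ResolutionOfSingularities.ResolutionOfSingularities.Theorems.WeightedInvariantTerminatingCentreDatumRank
import Summits.ResolutionOfSingularities.ResolutionOfSingularities.Theorems.WeightedInvariantWeightedThesisHypersurfaceChoiceDimZero
import Summits.ResolutionOfSingularities.ResolutionOfSingularities.Theorems.WeightedInvariantWeightedThesisHypersurfaceChoiceDimTower
import HarnessLib

/-!
# The door datum BY TRANSVERSAL DIMENSION — the e-ladder of `HypersurfaceTerminatingCentreDatum p`

Route `ResolutionOfSingularities/WeightedInvariant`, crux `Theses.WeightedInvariant.HypersurfaceCentreConstruction`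
(stmt-ResolutionOfSingularities-19897: `∀ p prime, Nonempty (HypersurfaceTerminatingCentreDatum p)`), door line
`local-engine`; CRUX-PLAN r1 §v6.2/§v6.4 (4) of `res-L1-w43-plan-1` («FIRST HONEST REGIME for H2 (BC5-style
witnesses of the door, NOT progress on H2): the e-ladder … rung statements for e = 1, 2 typed over the NEW
datum»), CHAIN w43 v4.3 ARRIVAL TABLE row `res-L1-w43-stub-10`, and the forward ladder
`Cruxes/GlobalizeLocalDrop/LADDER-GlobalizeLocalDrop.md` (transversal dimension as the ladder variable).

The tree types the OLD door's e-ladder `HypersurfaceCentreChoiceDim p e` (`Theorems/…HypersurfaceChoiceDim.lean`: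
the obligations of a `HypersurfaceCentreChoice p` demanded only on the pairs REACHED IN TRANSVERSAL DIMENSION `e`
along the towers of the centre rule, `HypersurfacePair.ReachDim`; rung `e = 0` inhabited,
`Theorems/…HypersurfaceChoiceDimZero.lean`; consumer `weightedThesis_of_hypersurfaceChoiceDim_of_forall_berghRydh_charP`,
`Theorems/…HypersurfaceChoiceDimTower.lean`).  This file types the SAME ladder over the NEW door datum
`HypersurfaceTerminatingCentreDatum p` (`Theorems/…TerminatingCentreDatum.lean`), which differs from a choice
exactly by `(iii-b′)` «support ⊆ non-minimal locus of the rating» (stronger than `(ii′)`) and by a `Λ`-valued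
`rank` with `(term)` (instead of `(T)`):

* `HypersurfaceTerminatingCentreDatumDim p e` — the new datum VERBATIM (`Γ`, `inv`, `centre`, `Λ`, `rank`,
  `(ii)`), with `(iii-a)`, `(iii-b′)`, `(hom)`, `(term)` demanded only on hypersurface pairs reached in
  transversal dimension `e` along the towers of `centre`.  **RUNG `e` of the door is
  `Nonempty (HypersurfaceTerminatingCentreDatumDim p e)`.**
* `HypersurfaceTerminatingCentreDatumDim.ofDatum` — the door datum is a datum in every transversal dimension
  (forget the guards); `forall_nonempty_dim_of_hypersurfaceCentreConstruction` — the door item gives every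
  rung.
* `HypersurfaceTerminatingCentreDatumDim.toChoiceDim` — H1c SLICED: a datum in transversal dimension `e` is a
  `HypersurfaceCentreChoiceDim p e` (same centre; `(T)` on the reachability class from `(term)`, `(ii′)` from
  `(iii-b′)` + `(ii)` at the generic point).
* `hyp_nonempty_terminatingDim_zero` — **rung `e = 0` is inhabited** (vacuous: a pair reached in transversal
  dimension `0` is regular, `HypersurfacePair.isRegular_of_reachDim_zero`).
* `weightedThesis_of_hypersurfaceTerminatingCentreDatumDim_of_forall_berghRydh_charP` — CONSUMER: the rungs
  at every prime and every `e`, and prime-wise Bergh–Rydh, give `WeightedThesis` (RESHAPE 9's tower for choices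
  in one reachability class ∘ `toChoiceDim`).

So the e-ladder sits BY NAME between the door item (⇒ every rung) and the summit modulo Bergh–Rydh (⇐ all
rungs).  Rungs `e = 1` (Abramovich–Quek–Schober 2025, arXiv:2507.01232 Thm. 1.1: torus-equivariant weighted
resolution of curves) and `e = 2` (embedded surfaces) are the first honest regimes; their closed-modulo-facts
plans are recorded in the stub worker's plan note (cell res-hironaka, `D/res-D-pv-025/DOOR-ELADDER-PLAN.md`).
Nothing here is a claim about Hironaka's problem; no rung `e ≥ 1` is asserted.
-/

noncomputable section

open CategoryTheory AlgebraicGeometry TopologicalSpace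
open Literature.AlgebraicGeometry.Resolution

set_option linter.dupNamespace false -- mandated namespace of this single-conjunct summit

namespace Summit.ResolutionOfSingularities.ResolutionOfSingularities.Theorems

/-! ## The door datum in transversal dimension `e` -/

/-- **Hypersurface terminating weighted-centre datum in characteristic `p` and TRANSVERSAL DIMENSION `e`**
(object of door line `local-engine` of crux `HypersurfaceCentreConstruction`, stmt-19897 — the door as a
ladder): the data of a `HypersurfaceTerminatingCentreDatum p` — a linearly ordered `Γ` and a total rating
`inv f X : Y → Γ` with `(ii)` «`inv` minimal at `y` iff `V(X)` is regular over `y`» on hypersurface pairs, a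
total centre rule `centre f X : ReesAlgebraData Y`, a well-ordered `Λ` and a total `rank f X : Λ` of pairs —
whose remaining axioms are demanded ONLY on the hypersurface pairs `P` over perfect fields of characteristic
`p` that are REACHED IN TRANSVERSAL DIMENSION `e` along the towers of `centre` (`HypersurfacePair.ReachDim`:
from a start pair whose integral hypersurface has dimension `e`, by finitely many global cobordant blow-ups
of the centre with the strict transform) and satisfy the guard «`inv` not everywhere minimal» (= `V(X(P))` not
regular): `(iii-a)` the centre is a regular weighted centre, `(iii-b′)` its support lies in the non-minimal
locus of `inv`, `(hom)` every piece is homogeneous on every `ℤʲ`-graded affine chart of the pair (constants in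
degree `0`, `X(W)` homogeneous), `(term)` the rank drops to the canonical successor
`(B₊ → Y → Spec k, σˢ(X)|_{B₊})` along every Rees filtration with the pieces of the centre.  Every door datum is
one in every transversal dimension (`ofDatum`); every one is a `HypersurfaceCentreChoiceDim p e`
(`toChoiceDim`).  RUNG `e` of the door ladder := `Nonempty (HypersurfaceTerminatingCentreDatumDim p e)`;
`e = 0` is inhabited (`hyp_nonempty_terminatingDim_zero`), `e = 1` is the sector of Abramovich–Quek–Schober's
torus-equivariant weighted resolution of curves (arXiv:2507.01232, Thm. 1.1), `e = 2` that of embedded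
surfaces.  CANDIDATE interface, not a claim. -/
structure HypersurfaceTerminatingCentreDatumDim (p e : ℕ) : Type 1 where
  /-- the value set of the rating -/
  Γ : Type
  /-- `Γ` is linearly ordered (NOT assumed well-founded) -/
  [linearOrder : LinearOrder Γ]
  /-- the rating `inv_{(Y,X)} : |Y| → Γ` (total; consumed only through `(ii)`) -/
  inv : ∀ ⦃k : Type⦄ [Field k] ⦃Y : Scheme.{0}⦄, (Y ⟶ Spec (.of k)) → Y.IdealSheafData → Y → Γ
  /-- the weighted centre of `(Y, X)`, as a Rees algebra on `Y` (total) -/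
  centre : ∀ ⦃k : Type⦄ [Field k] ⦃Y : Scheme.{0}⦄, (Y ⟶ Spec (.of k)) → Y.IdealSheafData →
    ReesAlgebraData Y
  /-- the value set of the termination rank -/
  Λ : Type
  /-- `Λ` is linearly ordered … -/
  [linearOrderRank : LinearOrder Λ]
  /-- … and well-ordered -/
  [wellFoundedLTRank : WellFoundedLT Λ]
  /-- the termination rank of a PAIR (total) -/
  rank : ∀ ⦃k : Type⦄ [Field k] ⦃Y : Scheme.{0}⦄, (Y ⟶ Spec (.of k)) → Y.IdealSheafData → Λ
  /-- `(ii)` on hypersurface pairs (verbatim the door datum's) -/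
  isBot_inv_iff : ∀ ⦃k : Type⦄ [Field k] [CharP k p] [PerfectField k] ⦃Y : Scheme.{0}⦄
    (f : Y ⟶ Spec (.of k)) [Smooth f] [IsSeparated f] [QuasiCompact f] (X : Y.IdealSheafData),
    IsLocallyPrincipal X → IsIntegral X.subscheme → ∀ (y : Y), IsBot (inv f X y) ↔
      ∀ x : X.subscheme, X.subschemeι x = y → IsRegularLocalRing (X.subscheme.presheaf.stalk x)
  /-- `(iii-a)` [pairs reached in transversal dimension `e`; guard] the centre is a regular weighted
  centre -/
  isRegularWeightedCentre_centre : ∀ ⦃k : Type⦄ [Field k] [CharP k p] [PerfectField k]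
    (P : HypersurfacePair k),
    HypersurfacePair.ReachDim (fun ⦃Y : Scheme.{0}⦄ (f : Y ⟶ Spec (.of k)) X => centre f X) e P →
    (∃ y : P.Y, ¬ IsBot (inv P.f P.X y)) → (centre P.f P.X).IsRegularWeightedCentre
  /-- `(iii-b′)` [pairs reached in transversal dimension `e`; guard] the support of the centre lies in the
  non-minimal locus of `inv` -/
  support_centre_subset : ∀ ⦃k : Type⦄ [Field k] [CharP k p] [PerfectField k]
    (P : HypersurfacePair k),
    HypersurfacePair.ReachDim (fun ⦃Y : Scheme.{0}⦄ (f : Y ⟶ Spec (.of k)) X => centre f X) e P →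
    (∃ y : P.Y, ¬ IsBot (inv P.f P.X y)) →
    (centre P.f P.X).support ⊆ {y : P.Y | ¬ IsBot (inv P.f P.X y)}
  /-- `(hom)` [pairs reached in transversal dimension `e`; guard] on a `ℤʲ`-graded affine chart `W`
  (constants in degree `0`, `X(W)` homogeneous) every piece of the centre is homogeneous -/
  centre_isHomogeneous : ∀ ⦃k : Type⦄ [Field k] [CharP k p] [PerfectField k]
    (P : HypersurfacePair k),
    HypersurfacePair.ReachDim (fun ⦃Y : Scheme.{0}⦄ (f : Y ⟶ Spec (.of k)) X => centre f X) e P →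
    (∃ y : P.Y, ¬ IsBot (inv P.f P.X y)) →
    ∀ (j : ℕ) (W : P.Y.affineOpens) (𝒜 : (Fin j → ℤ) → AddSubgroup Γ(P.Y, W)) [GradedRing 𝒜],
      (∀ c : Γ(Spec (.of k), ⊤), P.f.appLE ⊤ W le_top c ∈ 𝒜 0) →
      (P.X.ideal W).IsHomogeneous 𝒜 →
      ∀ n : ℕ, (((centre P.f P.X).piece n).ideal W).IsHomogeneous 𝒜
  /-- `(term)` [pairs reached in transversal dimension `e`; guard] the rank drops to the canonical
  successor pair along every Rees filtration with the pieces of the centre -/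
  rank_lt : ∀ ⦃k : Type⦄ [Field k] [CharP k p] [PerfectField k]
    (P : HypersurfacePair k),
    HypersurfacePair.ReachDim (fun ⦃Y : Scheme.{0}⦄ (f : Y ⟶ Spec (.of k)) X => centre f X) e P →
    (∃ y : P.Y, ¬ IsBot (inv P.f P.X y)) →
    ∀ (R' : ReesFiltration P.Y), R'.ideal = (centre P.f P.X).piece →
      rank (R'.πPlus ≫ P.f) (R'.strictTransformPlus P.X) < rank P.f P.X

namespace HypersurfaceTerminatingCentreDatumDim

variable {p e : ℕ} (E : HypersurfaceTerminatingCentreDatumDim p e)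

/-- The value set of the rating is linearly ordered (structure field as an instance). [folklore] -/
instance instLinearOrder : LinearOrder E.Γ := E.linearOrder

/-- The rank set is linearly ordered (structure field as an instance). [folklore] -/
instance instLinearOrderRank : LinearOrder E.Λ := E.linearOrderRank

/-- The rank set is well-ordered (structure field as an instance). [folklore] -/
instance instWellFoundedLTRank : WellFoundedLT E.Λ := E.wellFoundedLTRank

/-- The centre rule of `E` over the field `k`, in the shape `HypersurfacePair.Step` / `ReachDim` consume.
[folklore] -/
abbrev centreRule (k : Type) [Field k] :
    ∀ ⦃Y : Scheme.{0}⦄, (Y ⟶ Spec (.of k)) → Y.IdealSheafData → ReesAlgebraData Y :=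
  fun ⦃_⦄ f X => E.centre f X

/-! ### The guard -/

section Guard

variable {k : Type} [Field k] [CharP k p] [PerfectField k]

/-- `(ii)` globally on a hypersurface pair: `inv` is everywhere minimal iff `V(X)` is regular. [folklore] -/
theorem forall_isBot_inv_iff (P : HypersurfacePair k) :
    (∀ y : P.Y, IsBot (E.inv P.f P.X y)) ↔ Scheme.IsRegular P.X.subscheme := by
  constructor
  · intro h x
    exact (E.isBot_inv_iff P.f P.X P.isLocallyPrincipal P.isIntegral (P.X.subschemeι x)).mp (h _) x rfl
  · intro h y
    rw [E.isBot_inv_iff P.f P.X P.isLocallyPrincipal P.isIntegral y]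
    exact fun x _ => h x

/-- **The guard from non-regularity** (`(ii)` contraposed): on a hypersurface pair whose hypersurface is
not regular the rating is somewhere non-minimal. [folklore] -/
theorem exists_not_isBot_inv_of_not_isRegular (P : HypersurfacePair k)
    (hsing : ¬ Scheme.IsRegular P.X.subscheme) : ∃ y : P.Y, ¬ IsBot (E.inv P.f P.X y) := by
  by_contra hcon
  push Not at hcon
  exact hsing ((E.forall_isBot_inv_iff P).mp hcon)

/-- `(ii)` at the generic point of the hypersurface of a closed immersion from an integral scheme: the
rating is minimal there (the function field is a regular local ring). [folklore] -/
theorem isBot_inv_genericPoint {Y X : Scheme.{0}} (f : Y ⟶ Spec (.of k)) [Smooth f] [IsSeparated f]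
    [QuasiCompact f] (i : X ⟶ Y) [IsClosedImmersion i] [IsIntegral X] (hlp : IsLocallyPrincipal i.ker) :
    IsBot (E.inv f i.ker (i (genericPoint X))) := by
  have hXi : IsIntegral i.ker.subscheme := HypersurfaceTower.isIntegral_ker_subscheme i
  rw [E.isBot_inv_iff f i.ker hlp hXi]
  intro x' hx'
  obtain ⟨x₀, rfl⟩ := i.toImage.surjective x'
  rw [toImage_apply_eq_iff] at hx'
  obtain rfl : x₀ = genericPoint X := i.isClosedEmbedding.injective hx'
  exact (isRegularLocalRing_stalk_image_iff i (genericPoint X)).mpr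
    (inferInstanceAs (IsRegularLocalRing X.functionField))

/-- **`(ii′)` for a datum in transversal dimension `e`**: on a pair `(Y, ker i)` reached in transversal
dimension `e` with `X` not regular, the generic point of `X` is off the centre (`(iii-b′)` puts the centre in
the non-minimal locus of `inv`, `(ii)` makes `inv` minimal at the generic point). [folklore] -/
theorem genericPoint_not_mem_support_centre {Y X : Scheme.{0}} (f : Y ⟶ Spec (.of k)) [Smooth f]
    [IsSeparated f] [QuasiCompact f] (i : X ⟶ Y) [IsClosedImmersion i] [IsIntegral X]
    (hlp : IsLocallyPrincipal i.ker)
    (hreach : HypersurfacePair.ReachDim (E.centreRule k) e (HypersurfacePair.ofKer f i hlp))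
    (hsing : ¬ Scheme.IsRegular X) : i (genericPoint X) ∉ (E.centre f i.ker).support := by
  have hsing' : ¬ Scheme.IsRegular (HypersurfacePair.ofKer f i hlp).X.subscheme :=
    fun h => hsing ((isRegular_iff_isRegular_image i).mpr h)
  intro hmem
  exact E.support_centre_subset (HypersurfacePair.ofKer f i hlp) hreach
    (E.exists_not_isBot_inv_of_not_isRegular _ hsing') hmem (E.isBot_inv_genericPoint f i hlp)

end Guard

/-! ### The door datum is a datum in every transversal dimension -/

/-- **Every hypersurface terminating centre datum is one in every transversal dimension** (forget the
reachability guards; all data kept). [folklore] -/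
def ofDatum (E : HypersurfaceTerminatingCentreDatum p) (e : ℕ) :
    HypersurfaceTerminatingCentreDatumDim p e where
  Γ := E.Γ
  inv := E.inv
  centre := E.centre
  Λ := E.Λ
  rank := E.rank
  isBot_inv_iff := fun _ _ _ _ _ f _ _ _ X hX hXi y => E.isBot_inv_iff f X hX hXi y
  isRegularWeightedCentre_centre := fun _ _ _ _ P _ h =>
    E.isRegularWeightedCentre_centre P.f P.X P.isLocallyPrincipal P.isIntegral h
  support_centre_subset := fun _ _ _ _ P _ h =>
    E.support_centre_subset P.f P.X P.isLocallyPrincipal P.isIntegral h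
  centre_isHomogeneous := fun _ _ _ _ P _ h j W 𝒜 _ h0 hX n =>
    E.centre_isHomogeneous P.f P.X P.isLocallyPrincipal P.isIntegral h j W 𝒜 h0 hX n
  rank_lt := fun _ _ _ _ P _ h R' hR' =>
    E.rank_lt P.f P.X P.isLocallyPrincipal P.isIntegral h R' hR'

/-- `ofDatum` keeps the centre. [folklore] -/
@[simp] theorem ofDatum_centre (E : HypersurfaceTerminatingCentreDatum p) (e : ℕ) :
    (ofDatum E e).centre = E.centre := rfl

/-- **Door datum ⇒ every rung.** [folklore] -/
theorem nonempty_of_nonempty_datum (h : Nonempty (HypersurfaceTerminatingCentreDatum p)) (e : ℕ) :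
    Nonempty (HypersurfaceTerminatingCentreDatumDim p e) :=
  h.map fun E => ofDatum E e

/-! ### H1c sliced: a datum in transversal dimension `e` is a choice in transversal dimension `e` -/

/-- **`(T)` on the reachability class** — the restricted tower-step relation
`ReachDim centre e P ∧ Step centre P' P` is well-founded over every perfect field of characteristic `p`: a
step from a reached (singular) pair strictly lowers the rank by `(term)`, so the relation is a subrelation of
the inverse image of `<` on the well-ordered `Λ`. [folklore] -/
theorem wellFounded_reachStep {k : Type} [Field k] [CharP k p] [PerfectField k] :
    WellFounded fun P' P : HypersurfacePair k =>
      HypersurfacePair.ReachDim (E.centreRule k) e P ∧ HypersurfacePair.Step (E.centreRule k) P' P := by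
  refine Subrelation.wf (r := InvImage (· < ·) fun P : HypersurfacePair k => E.rank P.f P.X) ?_
    (InvImage.wf _ wellFounded_lt)
  intro P' P h
  obtain ⟨hreach, hsing, R', hR', hs, hsep, hqc, hlp, hint, rfl⟩ := h
  exact E.rank_lt P hreach (E.exists_not_isBot_inv_of_not_isRegular P hsing) R' hR'

/-- **H1c SLICED — every hypersurface terminating centre datum in transversal dimension `e` is a
hypersurface centre choice in transversal dimension `e`** (keep the centre; `(iii)`/`(H)` = `(iii-a)`/`(hom)`
under the guard from `(ii)`; `(ii′)` = `genericPoint_not_mem_support_centre`; `(T)` = `wellFounded_reachStep`).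
[folklore] -/
def toChoiceDim : HypersurfaceCentreChoiceDim p e where
  centre := E.centre
  isRegularWeightedCentre_centre := fun _ _ _ _ P hP hsing =>
    E.isRegularWeightedCentre_centre P hP (E.exists_not_isBot_inv_of_not_isRegular P hsing)
  genericPoint_not_mem_support_centre := fun _ _ _ _ _ _ f _ _ _ i _ _ hlp hP hsing =>
    E.genericPoint_not_mem_support_centre f i hlp hP hsing
  centre_isHomogeneous := fun _ _ _ _ P hP hsing _ W 𝒢 _ h0 hXhom n =>
    E.centre_isHomogeneous P hP (E.exists_not_isBot_inv_of_not_isRegular P hsing) _ W 𝒢 h0 hXhom n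
  wellFounded_step := fun _ _ _ _ => E.wellFounded_reachStep

/-- `toChoiceDim` keeps the centre. [folklore] -/
@[simp] theorem toChoiceDim_centre : E.toChoiceDim.centre = E.centre := rfl

/-- **Rung `e` of the door ⇒ rung `e` of the choice ladder.** [folklore] -/
theorem nonempty_choiceDim_of_nonempty (h : Nonempty (HypersurfaceTerminatingCentreDatumDim p e)) :
    Nonempty (HypersurfaceCentreChoiceDim p e) :=
  h.map toChoiceDim

end HypersurfaceTerminatingCentreDatumDim

/-! ## The door item gives every rung -/

/-- **`HypersurfaceCentreConstruction` (stmt-19897) ⇒ every rung of its e-ladder**, prime by prime: the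
door datum at `p` is a datum in every transversal dimension at `p` (`ofDatum`). The on-path implication
«crux → rung» of the forward ladder. [folklore] -/
theorem forall_nonempty_dim_of_hypersurfaceCentreConstruction
    (h : Summit.ResolutionOfSingularities.ResolutionOfSingularities.Theses.WeightedInvariant.HypersurfaceCentreConstruction)
    (p : ℕ) (hp : p.Prime) (e : ℕ) : Nonempty (HypersurfaceTerminatingCentreDatumDim p e) :=
  HypersurfaceTerminatingCentreDatumDim.nonempty_of_nonempty_datum (h p hp) e

/-! ## Rung `e = 0` is inhabited -/

/-- **The bottom rung of the door ladder: `HypersurfaceTerminatingCentreDatumDim p 0` is inhabited for every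
`p`** — rate by `CentreRankDatum.singRating` (`Γ := Bool`, `(ii)` = `isBot_singRating_iff`), take the unit Rees
algebra as the centre and the constant rank `0 : ℕ`; every guarded obligation is vacuous because a pair reached
in transversal dimension `0` has a regular hypersurface (`HypersurfacePair.isRegular_of_reachDim_zero`), so its
rating is everywhere minimal. The sanity inhabitant of the ladder, exactly as `hyp_nonempty_choiceDim_zero` for
the choice ladder. [folklore] -/
theorem hyp_nonempty_terminatingDim_zero (p : ℕ) : Nonempty (HypersurfaceTerminatingCentreDatumDim p 0) := by
  have vac : ∀ {k : Type} [Field k] (c : ∀ ⦃Y : Scheme.{0}⦄, (Y ⟶ Spec (.of k)) → Y.IdealSheafData →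
      ReesAlgebraData Y) (P : HypersurfacePair k), HypersurfacePair.ReachDim c 0 P →
      (∃ y : P.Y, ¬ IsBot (CentreRankDatum.singRating P.X y)) → False := by
    intro k _ c P hP h
    exact (CentreRankDatum.exists_not_isBot_singRating_iff P.X).mp h
      (HypersurfacePair.isRegular_of_reachDim_zero hP)
  exact ⟨{
    Γ := Bool
    inv := fun _ _ _ _ X y => CentreRankDatum.singRating X y
    centre := fun _ _ Y _ _ => ReesAlgebraData.unit Y
    Λ := ℕ
    rank := fun _ _ _ _ _ => 0
    isBot_inv_iff := fun _ _ _ _ _ _ _ _ _ X _ _ y => CentreRankDatum.isBot_singRating_iff X y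
    isRegularWeightedCentre_centre := fun _ _ _ _ P hP h => (vac _ P hP h).elim
    support_centre_subset := fun _ _ _ _ P hP h => (vac _ P hP h).elim
    centre_isHomogeneous := fun _ _ _ _ P hP h => (vac _ P hP h).elim
    rank_lt := fun _ _ _ _ P hP h => (vac _ P hP h).elim }⟩

/-! ## The consumer: all rungs at every prime, and prime-wise Bergh–Rydh, give `WeightedThesis` -/

/-- **`WeightedThesis` from the door's e-ladder and the characteristic-`p` instances of Bergh–Rydh**: if for
every prime `p` and every `e : ℕ` rung `e` of the door holds (`Nonempty (HypersurfaceTerminatingCentreDatumDim p e)`;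
implied by the door item through `forall_nonempty_dim_of_hypersurfaceCentreConstruction`), and for every prime
`p` and every perfect field `k` of characteristic `p` every integral separated finite-type `k`-scheme with finite
diagonalizable quotient singularities étale-locally has a resolution, then every reduced separated scheme of
finite type over every perfect field of positive characteristic has a resolution — H1c sliced (`toChoiceDim`)
followed by RESHAPE 9's tower inside one reachability class
(`weightedThesis_of_hypersurfaceChoiceDim_of_forall_berghRydh_charP`).
[cite: Wlodarczyk2022, Thm 1.1.6; BerghRydh2019, Thm 5; AbramovichTemkinWlodarczyk2024, §1.9] -/
theorem weightedThesis_of_hypersurfaceTerminatingCentreDatumDim_of_forall_berghRydh_charP :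
    (∀ p : ℕ, p.Prime → ∀ e : ℕ, Nonempty (HypersurfaceTerminatingCentreDatumDim p e)) →
    (∀ p : ℕ, p.Prime → ∀ (k : Type) [Field k] [CharP k p] [PerfectField k] (V : Scheme.{0})
      (g : V ⟶ Spec (.of k)) [IsIntegral V] [IsSeparated g] [LocallyOfFiniteType g] [QuasiCompact g],
      (∀ v : V, ∃ (A : Type) (_ : AddCommGroup A) (_ : Finite A) (_ : DecidableEq A)
        (S : Type) (_ : CommRing S) (_ : Algebra k S) (𝒮 : A → Submodule k S)
        (_ : GradedAlgebra 𝒮), Algebra.FiniteType k S ∧ Algebra.Smooth k S ∧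
        ∃ φ : Spec (.of (𝒮 0)) ⟶ V, Etale φ ∧ v ∈ Set.range φ ∧
          φ ≫ g = Spec.map (CommRingCat.ofHom (algebraMap k (𝒮 0)))) →
      Scheme.HasResolution V) →
    Summit.ResolutionOfSingularities.ResolutionOfSingularities.Theses.WeightedInvariant.WeightedThesis :=
  fun hE => weightedThesis_of_hypersurfaceChoiceDim_of_forall_berghRydh_charP
    fun p hp e => (hE p hp e).map HypersurfaceTerminatingCentreDatumDim.toChoiceDim

end Summit.ResolutionOfSingularities.ResolutionOfSingularities.Theorems

end
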